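import Mathlib
import Literature.Computability.AlgebraicComplexity.PermanentIrreducible
import Literature.Computability.AlgebraicComplexity.StandardFamiliesProofs

/-!
# Crux `DivisionGap.PerCofactorDegreeReduction` (stmt-ValiantsHypothesis-15046), line `Sketch` —
# stub `stub_supportRung`: every nonzero multiple of the permanent has at least `n!` monomials

**Theorem (`stub_supportRung`).** For every `n` and every nonzero `q ∈ ℝ[x_ij]` (`n × n` variables),
the product `per_n · q` has at least `n!` monomials in its support.

This is the sparsity rung for (possibly SIGNED) real cofactors of cheap nonnegative elements of the
ideal `(per_n)`: Ostrowski's `Newt(f g) = Newt f + Newt g` read vertex by vertex, proved here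
WITHOUT polytopes, by leading monomials under `n!` lexicographic monomial orders.

## Proof

*Abstract vertex count* (`card_le_card_support_mul`).  Fix a linearly ordered variable type `τ`
and Mathlib's lexicographic monomial order `lex` on `τ →₀ ℕ`.  For an equivalence `E : σ ≃ τ`,
`rename E` is an injective ring map and `coeff (d ∘ E⁻¹) (rename E p) = coeff d p`
(`MvPolynomial.coeff_rename_mapDomain`), so the `lex`-leading exponent of `rename E p` pulls back
to an exponent `ldeg_E p ∈ supp p` dominating (after transport) every exponent of `p`, and
`ldeg_E (f g) = ldeg_E f + ldeg_E g` over a domain (`MonomialOrder.degree_mul`).  If a family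
`E i` of such re-indexings has `ldeg_{E i} f = a i` with `i ↦ a i` injective, then
`i ↦ a i + ldeg_{E i} g ∈ supp (f g)` is injective: if `a i + b i = a j + b j` with `a i ≠ a j`,
compare along `E i` — there `a j ≺ a i` strictly and `b j ≼ b i`, so the sums differ
(`add_lt_add_of_lt_of_le` in the ordered cancellative monoid `lex.syn`).  Hence
`card ι ≤ card (supp (f g))` (`Finset.card_le_card_of_injOn`).

*The permanent* (`stub_supportRung`).  Take `σ = Fin n × Fin n`, `τ = Fin (n · n)`, a fixed
`e : σ ≃ τ`, and for `π ∈ 𝔖_n` the row permutation `ρ_π = (i, j) ↦ (π i, j)` and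
`E π = e ∘ ρ_π`.  Row permutations permute the permutation monomials,
`μ_σ ∘ ρ_π⁻¹ = μ_{π σ}` (`mapDomain_rowPerm_permMonomial`, from `permMonomial_apply`), so
`rename ρ_π per_n = per_n` (`rename_rowPerm_perPoly`, via `perPoly_eq_sum_monomial`).  The
`lex`-leading exponent of `rename e per_n` is `μ_{σ₀} ∘ e⁻¹` for SOME permutation `σ₀`
(`exists_permMonomial_eq_of_coeff_perPoly_ne_zero`; which one is irrelevant), hence
`ldeg_{E π} per_n = μ_{π⁻¹ σ₀}`, injective in `π` (`permMonomial_injective`), and the abstract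
count gives `n! = card 𝔖_n ≤ card (supp (per_n · q))` (`Fintype.card_perm`).  At `n = 0` the
same argument applies verbatim (`per_0 = 1`, one permutation).

Design: no definitions; the abstract count is stated for an arbitrary commutative semiring without
zero divisors.  Leans on Mathlib (`MonomialOrder.lex`, `MonomialOrder.degree_mul`,
`MonomialOrder.degree_mem_support`, `MonomialOrder.le_degree`) and the tree files
`Literature/Computability/AlgebraicComplexity/PermanentIrreducible.lean`,
`Literature/Computability/AlgebraicComplexity/StandardFamiliesProofs.lean` (`perPoly_ne_zero`) only.
-/

noncomputable section

-- `Summit.ValiantsHypothesis.ValiantsHypothesis.…` is the tree's mandated single-conjunct layout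
-- (Problem = Summit), so the duplicated namespace component is intended.
set_option linter.dupNamespace false

namespace Summit.ValiantsHypothesis.ValiantsHypothesis.Theorems.DivisionGap.PerCofactorDegreeReduction.SupportRung

open MvPolynomial Literature.Computability.AlgebraicComplexity
open scoped BigOperators MonomialOrder

/-! ### Leading exponents along a re-indexing of the variables -/

section Leading

variable {σ τ R : Type*} [CommSemiring R]

/-- **Transport of supports.**  For an equivalence `E : σ ≃ τ` of variable types,
`d ∘ E⁻¹ ∈ supp (rename E p) ↔ d ∈ supp p` (`MvPolynomial.coeff_rename_mapDomain`). [folklore] -/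
theorem mapDomain_mem_support_rename_iff (E : σ ≃ τ) (p : MvPolynomial σ R) (d : σ →₀ ℕ) :
    Finsupp.mapDomain E d ∈ (rename E p).support ↔ d ∈ p.support := by
  rw [mem_support_iff, mem_support_iff, coeff_rename_mapDomain E E.injective]

/-- `(d ∘ E) ∘ E⁻¹ = d` for exponents: `mapDomain E ∘ mapDomain E⁻¹ = id`. [folklore] -/
theorem mapDomain_mapDomain_symm (E : σ ≃ τ) (d : τ →₀ ℕ) :
    Finsupp.mapDomain E (Finsupp.mapDomain E.symm d) = d := by
  rw [← Finsupp.mapDomain_comp, Equiv.self_comp_symm, Finsupp.mapDomain_id]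

/-- Renaming along an equivalence preserves being nonzero (`MvPolynomial.rename_injective`).
[folklore] -/
theorem rename_equiv_ne_zero (E : σ ≃ τ) {p : MvPolynomial σ R} (hp : p ≠ 0) :
    rename E p ≠ 0 :=
  fun h => hp ((rename_eq_zero_iff_of_injective p E.injective).1 h)

variable [LinearOrder τ] [WellFoundedGT τ]

/-- **Every exponent is dominated by the leading one.**  If `d ∈ supp p` then, transported along
`E`, `d ∘ E⁻¹ ≼ lex-deg (rename E p)` (`MonomialOrder.le_degree`). [folklore] -/
theorem toSyn_mapDomain_le_degree_rename (E : σ ≃ τ) {p : MvPolynomial σ R} {d : σ →₀ ℕ}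
    (hd : d ∈ p.support) :
    MonomialOrder.lex.toSyn (Finsupp.mapDomain E d) ≤
      MonomialOrder.lex.toSyn (MonomialOrder.lex.degree (rename E p)) :=
  MonomialOrder.le_degree ((mapDomain_mem_support_rename_iff E p d).2 hd)

/-- **The pulled-back leading exponent lies in the support.**  For `p ≠ 0`,
`(lex-deg (rename E p)) ∘ E ∈ supp p` (`MonomialOrder.degree_mem_support`). [folklore] -/
theorem mapDomain_symm_degree_rename_mem_support (E : σ ≃ τ) {p : MvPolynomial σ R}
    (hp : p ≠ 0) :
    Finsupp.mapDomain E.symm (MonomialOrder.lex.degree (rename E p)) ∈ p.support := by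
  rw [← mapDomain_mem_support_rename_iff E, mapDomain_mapDomain_symm]
  exact MonomialOrder.degree_mem_support (rename_equiv_ne_zero E hp)

/-- **Vertex counting without polytopes.**  Let `R` have no zero divisors, `f g ≠ 0` in `R[σ]`,
and let `E i : σ ≃ τ` (`i ∈ ι`, `τ` linearly ordered) be re-indexings of the variables such that
the `lex`-leading exponent of `rename (E i) f` is `(a i) ∘ (E i)⁻¹` with `i ↦ a i` injective.
Then `card ι ≤ card (supp (f · g))`: the exponents `a i + b i`, `b i` the pulled-back leading
exponent of `g` along `E i`, lie in `supp (f g)` (`MonomialOrder.degree_mul`) and are pairwise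
distinct — if `a i + b i = a j + b j` with `a i ≠ a j` then along `E i` one has `a j ≺ a i`
strictly and `b j ≼ b i`, so the two sums differ (`add_lt_add_of_lt_of_le`).  This is Ostrowski's
"vertices of `Newt f` survive in `Newt (f g)`" for the vertices exposed by lexicographic orders.
[folklore] -/
theorem card_le_card_support_mul {ι : Type*} [Fintype ι] [NoZeroDivisors R]
    {f g : MvPolynomial σ R} (hf : f ≠ 0) (hg : g ≠ 0) (E : ι → σ ≃ τ) (a : ι → σ →₀ ℕ)
    (ha : Function.Injective a)
    (hlead : ∀ i, MonomialOrder.lex.degree (rename (E i) f) = Finsupp.mapDomain (E i) (a i)) :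
    Fintype.card ι ≤ (f * g).support.card := by
  classical
  -- the leading exponent of `g` along `E i`, pulled back to `σ`, and its two properties
  obtain ⟨b, hbmem, hbdeg⟩ : ∃ b : ι → σ →₀ ℕ, (∀ i, b i ∈ g.support) ∧
      ∀ i, MonomialOrder.lex.degree (rename (E i) g) = Finsupp.mapDomain (E i) (b i) :=
    ⟨fun i => Finsupp.mapDomain (E i).symm (MonomialOrder.lex.degree (rename (E i) g)),
      fun i => mapDomain_symm_degree_rename_mem_support (E i) hg,
      fun i => (mapDomain_mapDomain_symm (E i) _).symm⟩
  -- `a i` lies in the support of `f`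
  have hamem : ∀ i, a i ∈ f.support := fun i => by
    rw [← mapDomain_mem_support_rename_iff (E i), ← hlead i]
    exact MonomialOrder.degree_mem_support (rename_equiv_ne_zero (E i) hf)
  -- `a i + b i` is the pulled-back leading exponent of `f * g` along `E i`
  have hw : ∀ i, a i + b i ∈ (f * g).support := fun i => by
    rw [← mapDomain_mem_support_rename_iff (E i), Finsupp.mapDomain_add, ← hlead i, ← hbdeg i,
      map_mul, ← MonomialOrder.degree_mul (rename_equiv_ne_zero (E i) hf)
        (rename_equiv_ne_zero (E i) hg)]
    exact MonomialOrder.degree_mem_support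
      (mul_ne_zero (rename_equiv_ne_zero (E i) hf) (rename_equiv_ne_zero (E i) hg))
  -- and `i ↦ a i + b i` is injective: compare along `E i`
  have hinj : Function.Injective fun i => a i + b i := by
    intro i j hij
    change a i + b i = a j + b j at hij
    by_contra hne
    have hane : a j ≠ a i := fun h => hne (ha h).symm
    have h1 : MonomialOrder.lex.toSyn (Finsupp.mapDomain (E i) (a j)) <
        MonomialOrder.lex.toSyn (Finsupp.mapDomain (E i) (a i)) := by
      refine lt_of_le_of_ne ?_ fun h => hane
        (Finsupp.mapDomain_injective (E i).injective (MonomialOrder.lex.toSyn.injective h))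
      rw [← hlead i]
      exact toSyn_mapDomain_le_degree_rename (E i) (hamem j)
    have h2 : MonomialOrder.lex.toSyn (Finsupp.mapDomain (E i) (b j)) ≤
        MonomialOrder.lex.toSyn (Finsupp.mapDomain (E i) (b i)) := by
      rw [← hbdeg i]
      exact toSyn_mapDomain_le_degree_rename (E i) (hbmem j)
    have h3 : MonomialOrder.lex.toSyn (Finsupp.mapDomain (E i) (a j + b j)) <
        MonomialOrder.lex.toSyn (Finsupp.mapDomain (E i) (a i + b i)) := by
      rw [Finsupp.mapDomain_add, Finsupp.mapDomain_add, map_add, map_add]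
      exact add_lt_add_of_lt_of_le h1 h2
    rw [hij] at h3
    exact lt_irrefl _ h3
  calc Fintype.card ι = (Finset.univ : Finset ι).card := Finset.card_univ.symm
    _ ≤ (f * g).support.card :=
      Finset.card_le_card_of_injOn (fun i => a i + b i) (fun i _ => Finset.mem_coe.2 (hw i))
        hinj.injOn

end Leading

/-! ### Row permutations and the permanent -/

variable {n : ℕ}

/-- **Row permutations permute the permutation monomials.**  With `ρ_π (i, j) = (π i, j)`,
`μ_σ ∘ ρ_π⁻¹ = μ_{π σ}`, i.e. `mapDomain ρ_π μ_σ = μ_{π σ}` (`permMonomial_apply`). [folklore] -/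
theorem mapDomain_rowPerm_permMonomial (π σ : Equiv.Perm (Fin n)) :
    Finsupp.mapDomain (Equiv.prodCongr π (Equiv.refl (Fin n))) (permMonomial σ) =
      permMonomial (π * σ) := by
  ext ⟨r, c⟩
  rw [Finsupp.mapDomain_equiv_apply, Equiv.prodCongr_symm, Equiv.prodCongr_apply, Equiv.refl_symm,
    Prod.map_apply, Equiv.refl_apply, permMonomial_apply, permMonomial_apply, Equiv.Perm.mul_apply]
  congr 1
  exact propext (Equiv.eq_symm_apply π)

/-- **The permanent is invariant under row permutations**: `per_n (x_{π i, j}) = per_n (x_{i j})`,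
by re-indexing `per_n = Σ_σ x^{μ_σ}` (`perPoly_eq_sum_monomial`) along `σ ↦ π σ`
(`mapDomain_rowPerm_permMonomial`). [folklore] -/
theorem rename_rowPerm_perPoly (π : Equiv.Perm (Fin n)) :
    rename (Equiv.prodCongr π (Equiv.refl (Fin n))) (perPoly (Fin n) ℝ) = perPoly (Fin n) ℝ := by
  rw [perPoly_eq_sum_monomial (n := Fin n) ℝ, map_sum]
  simp_rw [rename_monomial, mapDomain_rowPerm_permMonomial]
  exact Fintype.sum_equiv (Equiv.mulLeft π) _ _ fun σ => rfl

/-! ### The stub -/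

/-- **stub_supportRung — every nonzero element of the ideal `(per_n)` has at least `n!` monomials.**
For `q ≠ 0` in `ℝ[x_ij]`, `n! ≤ card (supp (per_n · q))`.  Proof: fix `e : Fin n × Fin n ≃ Fin (n·n)`
and for `π ∈ 𝔖_n` the re-indexing `E π = e ∘ ρ_π`, `ρ_π (i, j) = (π i, j)`.  Since
`rename ρ_π per_n = per_n` (`rename_rowPerm_perPoly`) and the `lex`-leading exponent of
`rename e per_n` is `μ_{σ₀} ∘ e⁻¹` for some permutation `σ₀`
(`exists_permMonomial_eq_of_coeff_perPoly_ne_zero`), the leading exponent of `rename (E π) per_n`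
is `μ_{π⁻¹ σ₀} ∘ (E π)⁻¹` (`mapDomain_rowPerm_permMonomial`), with `π ↦ μ_{π⁻¹ σ₀}` injective
(`permMonomial_injective`); the abstract vertex count `card_le_card_support_mul` and
`card 𝔖_n = n!` (`Fintype.card_perm`) conclude.  The case `n = 0` is covered by the same argument.
[prime-walk-positivizer, sparsity rung] -/
theorem stub_supportRung (n : ℕ) (q : MvPolynomial (Fin n × Fin n) ℝ) (hq : q ≠ 0) :
    n.factorial ≤ (perPoly (Fin n) ℝ * q).support.card := by
  classical
  -- a linear order on the variables (any bijection with `Fin (n * n)` will do)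
  obtain ⟨e⟩ : Nonempty (Fin n × Fin n ≃ Fin (n * n)) := ⟨finProdFinEquiv⟩
  have hper : perPoly (Fin n) ℝ ≠ 0 := perPoly_ne_zero (Fin n) ℝ
  -- the `lex`-leading exponent of `per` along `e` is SOME permutation monomial
  obtain ⟨σ₀, hσ₀⟩ : ∃ σ₀ : Equiv.Perm (Fin n),
      MonomialOrder.lex.degree (rename e (perPoly (Fin n) ℝ)) =
        Finsupp.mapDomain e (permMonomial σ₀) := by
    obtain ⟨σ₀, h⟩ := exists_permMonomial_eq_of_coeff_perPoly_ne_zero ℝ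
      (mem_support_iff.1 (mapDomain_symm_degree_rename_mem_support e hper))
    exact ⟨σ₀, by rw [h, mapDomain_mapDomain_symm]⟩
  -- the abstract vertex count along the `n!` re-indexings `e ∘ ρ_π`
  have key := card_le_card_support_mul (ι := Equiv.Perm (Fin n)) hper hq
    (fun π => (Equiv.prodCongr π (Equiv.refl (Fin n))).trans e)
    (fun π => permMonomial (π⁻¹ * σ₀))
    (fun π π' h => inv_injective (mul_left_injective σ₀ (permMonomial_injective h)))
    fun π => by
      rw [Equiv.coe_trans, ← rename_rename, rename_rowPerm_perPoly, hσ₀, Finsupp.mapDomain_comp,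
        mapDomain_rowPerm_permMonomial, mul_inv_cancel_left]
  rwa [Fintype.card_perm, Fintype.card_fin] at key

end Summit.ValiantsHypothesis.ValiantsHypothesis.Theorems.DivisionGap.PerCofactorDegreeReduction.SupportRung

end
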